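import Summits.AtomisticToContinuum.HydrodynamicLimit.Theorems.StiffCollisionalRelaxationAprioriBoundsFibreDefs
import Summits.AtomisticToContinuum.HydrodynamicLimit.Theorems.JaynesSqueezeSqueezeToBlockGibbsTimeZeroLimit
import HarnessLib

/-!
# The equilibrium unit test of `TiltedExcessAt` (line `fibre-deficit-transfer`, crux `AprioriBounds`)

Support file (`--supports stmt-AtomisticToContinuum-14827`, registered sub-goal `tiltedExcess_equilibrium`) for
the stub `stub_tiltedExcess` of the skeleton of the line `fibre-deficit-transfer`
(vocabulary: `Theorems/StiffCollisionalRelaxationAprioriBoundsFibreDefs.lean`, namespace `…Theorems.FibreDeficitTransfer`).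

`TiltedExcessAt σ a₀ θ₀ u₀ ρ θ u t` asks that, eventually in `N` and for all `s ≤ t`,
`Z_N(Λ_s) ≤ exp (S(μ₀) + (N+1) m_s + C (N+1)^{1-c})`, where `Z_N(Λ_s) = tiltZ` is the partition function of the
Liouville measure tilted by the entropy-gradient field of the Euler state at time `s`, `S(μ₀) = gibbsEntropy` is
the Gibbs entropy of the initial local Gibbs law and `m_s = tiltMean` is the Euler mean of the tilt.  This file
checks the SIGNS AND NORMALISATIONS of that vocabulary on the equilibrium rung: for CONSTANT profiles
`(a₀, u₀, θ₀) ≡ (a_c, u_c, θ_c)` (any activity `a_c > 0`, the canonical law does not see it) and the constant Euler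
state `(ρ, u, θ) ≡ (1, u_c, θ_c)` the bracket vanishes IDENTICALLY, at every `N` and every `s`:

  `tiltZ = ofReal (exp (gibbsEntropy + (N+1) · tiltMean))`     (`tiltZ_equilibrium_eq`),

so `TiltedExcessAt` holds there with `C = 0` (`tiltedExcess_equilibrium`).  The three explicit evaluations are

* `tiltZ = Z_N(a_Λ)`, the canonical partition function of the local Gibbs profile with the constant SLICE
  ACTIVITY `a_Λ = e^{λ₀ + |u_c|²/2θ_c} (2πθ_c)^{3/2}` (`exp Λ·(1,v,|v|²/2) = a_Λ · M_{1,u_c,θ_c}(v)`,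
  `tiltExponent_eq_sq`; disintegration `lintegral_gibbsWeight_mul`), and `Z_N(a_Λ) = a_Λ^{N+1} Z_N(1)`;
* `gibbsEntropy = log Z_N(a_c) − (N+1)(log a_c + log (2πθ_c)^{-3/2}) + (3/2)(N+1)` (the log of the Gibbs
  density is `(N+1)⟨emp, log prof⟩ − log Z`, `MacroClosureLine.StubLedger.log_gibbsDensity`, and Gaussian
  equipartition `E ∑ᵢ|vᵢ − u_c|²/θ_c = 3(N+1)`, `JaynesSqueezeSqueeze.integral_sum_velFluct_velMeasure`), with
  `Z_N(a_c) = a_c^{N+1} Z_N(1)`;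
* `tiltMean = λ₀ + |u_c|²/(2θ_c) − 3/2` (unit volume of `𝕋³`),

and `log Z_N(1) + (N+1)[λ₀ + |u_c|²/2θ_c + (3/2) log 2πθ_c] = log Z_N(a_Λ)`: the per-particle constants
`(3/2) log 2πθ_c + 3/2` of the entropy cancel against the `−3/2` of the Euler mean and the Gaussian
normalisation hidden in `a_Λ`, whatever the (junk or genuine) values of `f_ex(σ³)`, `f_ex′(σ³)` inside `λ₀`.
No flow, no equation of state and no thermodynamic limit is used; `σ ≤ 1/2` only makes `Z_N > 0`.
-/

noncomputable section

open MeasureTheory Filter Set Topology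
open scoped ENNReal

namespace Summit.AtomisticToContinuum.HydrodynamicLimit.Theorems.FibreDeficitTransfer

open Literature.MathematicalPhysics.KineticTheory Literature.Analysis.FluidPDE
open Summit.AtomisticToContinuum.HydrodynamicLimit.Theorems.AprioriBoundsNegative (PartOneAt PartTwoAt)
open Summit.AtomisticToContinuum.HydrodynamicLimit.Theorems.VisitLedgerUpscattering (Cfg Flow Flows NiceProfiles)
open MacroClosureLine.StubLedger

namespace TiltedExcessEquilibrium

/-! ## Integration against the local Gibbs density (general continuous profiles) -/

variable {a₀ θ₀ : T3 → ℝ} {u₀ : T3 → V3}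

/-- The local Gibbs density is nonnegative (`a₀, θ₀ ≥ 0`). [folklore] -/
theorem dens_nonneg (σ : ℝ) (ha0 : ∀ x, 0 ≤ a₀ x) (hθ0 : ∀ x, 0 ≤ θ₀ x) (N : ℕ) (w : Cfg N) :
    0 ≤ dens σ a₀ u₀ θ₀ N w := by
  have hp : 0 ≤ localGibbsProfile a₀ u₀ θ₀ := fun y => localGibbsProfile_nonneg ha0 hθ0 y
  exact mul_nonneg (inv_nonneg.2 (canonicalPartition_nonneg _ _ _ hp))
    (Set.indicator_nonneg (fun z _ => tensorPow_nonneg hp _ z) w)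

/-- **`∫ f₀ · g dLiouville = ∫ g dμ₀`**: integrating `g` against the local Gibbs density w.r.t. the Liouville measure
is integrating `g` under the (flow-free) local Gibbs measure; no integrability is needed (both sides are
junk-consistent Bochner integrals). [folklore] -/
theorem integral_dens_mul (σ : ℝ) (ha : Continuous a₀) (hθ : Continuous θ₀) (hu : Continuous u₀)
    (ha0 : ∀ x, 0 ≤ a₀ x) (hθ0 : ∀ x, 0 ≤ θ₀ x) (N : ℕ) (g : Cfg N → ℝ) :
    ∫ w, dens σ a₀ u₀ θ₀ N w * g w ∂(liou σ N) = ∫ w, g w ∂(localGibbsMeasure σ a₀ u₀ θ₀ N) := by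
  have hDm : Measurable (dens σ a₀ u₀ θ₀ N) :=
    measurable_canonicalDensity _ _ (measurable_localGibbsProfile ha hθ hu)
  have h1 : ∫ w, dens σ a₀ u₀ θ₀ N w * g w ∂(liou σ N) = ∫ w, dens σ a₀ u₀ θ₀ N w * g w := by
    show ∫ w in hardSphereDomain (Torus.geometry (Fin 3)) (N + 1) (hsDiameter σ N), dens σ a₀ u₀ θ₀ N w * g w =
      ∫ w, dens σ a₀ u₀ θ₀ N w * g w
    refine setIntegral_eq_integral_of_forall_compl_eq_zero fun w hw => ?_
    rw [show dens σ a₀ u₀ θ₀ N w = 0 from canonicalDensity_eq_zero_of_notMem _ _ _ _ hw, zero_mul]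
  rw [h1, localGibbsMeasure, integral_withDensity_eq_integral_toReal_smul hDm.ennreal_ofReal
    (Eventually.of_forall fun _ => ENNReal.ofReal_lt_top)]
  refine integral_congr_ae (Eventually.of_forall fun w => ?_)
  simp only [ENNReal.toReal_ofReal (dens_nonneg σ ha0 hθ0 N w), smul_eq_mul]

/-- **The Gibbs entropy as an expectation**: `S(μ₀) = −E_{μ₀}[log f₀]`. [folklore] -/
theorem gibbsEntropy_eq_neg_integral (σ : ℝ) (ha : Continuous a₀) (hθ : Continuous θ₀) (hu : Continuous u₀)
    (ha0 : ∀ x, 0 ≤ a₀ x) (hθ0 : ∀ x, 0 ≤ θ₀ x) (N : ℕ) :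
    gibbsEntropy σ a₀ u₀ θ₀ N = -∫ w, Real.log (dens σ a₀ u₀ θ₀ N w) ∂(localGibbsMeasure σ a₀ u₀ θ₀ N) := by
  rw [gibbsEntropy, integral_dens_mul σ ha hθ hu ha0 hθ0 N]

/-- The local Gibbs measure lives on the hard-core domain. [folklore] -/
theorem ae_mem_hardSphereDomain (σ : ℝ) (ha : Continuous a₀) (hθ : Continuous θ₀) (hu : Continuous u₀) (N : ℕ) :
    ∀ᵐ w ∂(localGibbsMeasure σ a₀ u₀ θ₀ N),
      w ∈ hardSphereDomain (Torus.geometry (Fin 3)) (N + 1) (hsDiameter σ N) := by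
  rw [localGibbsMeasure, ae_withDensity_iff
    (measurable_canonicalDensity _ _ (measurable_localGibbsProfile ha hθ hu)).ennreal_ofReal]
  refine Eventually.of_forall fun w hw => ?_
  by_contra hmem
  exact hw (by rw [canonicalDensity_eq_zero_of_notMem _ _ _ _ hmem, ENNReal.ofReal_zero])

/-- **Gaussian equipartition under the flow-free local Gibbs measure**: for continuous profiles `a₀, θ₀ > 0`, `u₀`
and `σ ≤ 1/2`, `∑ᵢ |vᵢ − u₀(xᵢ)|²/θ₀(xᵢ)` is integrable with mean `3(N+1)` (conditionally on the positions the
velocities are independent `N(u₀(xᵢ), θ₀(xᵢ))`; the flow-free twin of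
`JaynesSqueezeSqueeze.integral_velFluct_localGibbsLaw`). [folklore] -/
theorem integral_velFluct_localGibbsMeasure {σ : ℝ} (hσ2 : σ ≤ 1 / 2) (ha : Continuous a₀) (hθ : Continuous θ₀)
    (hu : Continuous u₀) (ha0 : ∀ x, 0 < a₀ x) (hθ0 : ∀ x, 0 < θ₀ x) (N : ℕ) :
    Integrable (fun z : Cfg N => ∑ i, ‖(z i).2 - u₀ (z i).1‖ ^ 2 / θ₀ (z i).1) (localGibbsMeasure σ a₀ u₀ θ₀ N) ∧
      ∫ z, ∑ i, ‖(z i).2 - u₀ (z i).1‖ ^ 2 / θ₀ (z i).1 ∂(localGibbsMeasure σ a₀ u₀ θ₀ N) = 3 * ((N : ℝ) + 1) := by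
  -- adapted from `JaynesSqueezeSqueeze.integral_velFluct_localGibbsLaw` (flow-free, without the `(N+1)⁻¹`)
  haveI := isProbabilityMeasure_localGibbsMeasure ha hθ hu ha0 hθ0 hσ2 N
  set F : Cfg N → ℝ := fun z => ∑ i, ‖(z i).2 - u₀ (z i).1‖ ^ 2 / θ₀ (z i).1 with hF
  have hFm : Measurable F := Finset.measurable_sum _ fun i _ =>
    (((measurable_pi_apply i).snd.sub (hu.measurable.comp (measurable_pi_apply i).fst)).norm.pow_const 2).div
      (hθ.measurable.comp (measurable_pi_apply i).fst)
  have hF0 : ∀ z, 0 ≤ F z := fun z => Finset.sum_nonneg fun i _ => div_nonneg (sq_nonneg _) (hθ0 _).le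
  have hvel : ∀ x : Fin (N + 1) → T3,
      ∫⁻ v, ENNReal.ofReal (F (zipConfig (x, v))) ∂velMeasure u₀ θ₀ x = ENNReal.ofReal (3 * ((N : ℝ) + 1)) := by
    intro x
    obtain ⟨hint, hval⟩ := JaynesSqueezeSqueeze.integral_sum_velFluct_velMeasure (u₀ := u₀) hθ0 x
    have hFx : ∀ v : Fin (N + 1) → V3, F (zipConfig (x, v)) = ∑ i, ‖v i - u₀ (x i)‖ ^ 2 / θ₀ (x i) := by
      intro v; simp [hF, zipConfig_apply]
    simp_rw [hFx]
    rw [← ofReal_integral_eq_lintegral_ofReal hint (Eventually.of_forall fun v =>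
      Finset.sum_nonneg fun i _ => div_nonneg (sq_nonneg _) (hθ0 _).le), hval]
  have hlint : ∫⁻ z, ENNReal.ofReal (F z) ∂(localGibbsMeasure σ a₀ u₀ θ₀ N) = ENNReal.ofReal (3 * ((N : ℝ) + 1)) := by
    rw [lintegral_localGibbsMeasure ha hθ hu (fun x => (ha0 x).le) hθ0 σ N hFm.ennreal_ofReal]
    simp_rw [hvel]
    have hρm : Measurable fun x : Fin (N + 1) → T3 => ENNReal.ofReal
        ((canonicalPartition (Torus.geometry (Fin 3)) (hsDiameter σ N) (N + 1)
          (localGibbsProfile a₀ u₀ θ₀))⁻¹ * posWeight a₀ (hsDiameter σ N) (N + 1) x) :=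
      (measurable_const.mul (measurable_posWeight ha _ _)).ennreal_ofReal
    rw [lintegral_mul_const _ hρm, lintegral_posWeight_eq_one ha hθ hu (fun x => (ha0 x).le) hθ0 σ N, one_mul]
  have hInt : Integrable F (localGibbsMeasure σ a₀ u₀ θ₀ N) := by
    refine ⟨hFm.aestronglyMeasurable, ?_⟩
    rw [hasFiniteIntegral_iff_ofReal (Eventually.of_forall hF0), hlint]
    exact ENNReal.ofReal_lt_top
  refine ⟨hInt, ?_⟩
  rw [integral_eq_lintegral_of_nonneg_ae (Eventually.of_forall hF0) hFm.aestronglyMeasurable, hlint,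
    ENNReal.toReal_ofReal (by positivity)]

/-! ## Constant profiles: the Gibbs entropy -/

variable {σ ac θc : ℝ} {uc : V3}

/-- The log of the constant-profile local Gibbs density on the hard-core domain:
`log f₀(w) = (N+1)(log a_c + log (2πθ_c)^{-3/2}) − ∑ᵢ |vᵢ − u_c|²/(2θ_c) − log Z_N(a_c)`. [folklore] -/
theorem log_dens_const (hσ2 : σ ≤ 1 / 2) (hac : 0 < ac) (hθc : 0 < θc) (N : ℕ) {w : Cfg N}
    (hw : w ∈ hardSphereDomain (Torus.geometry (Fin 3)) (N + 1) (hsDiameter σ N)) :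
    Real.log (dens σ (fun _ => ac) (fun _ => uc) (fun _ => θc) N w) =
      ((N : ℝ) + 1) * (Real.log ac + Real.log ((2 * Real.pi * θc) ^ (-(Module.finrank ℝ V3 : ℝ) / 2))) -
        2⁻¹ * (∑ i, ‖(w i).2 - uc‖ ^ 2 / θc) -
        Real.log (canonicalPartition (Torus.geometry (Fin 3)) (hsDiameter σ N) (N + 1)
          (localGibbsProfile (fun _ => ac) (fun _ => uc) (fun _ => θc))) := by
  have hdens : dens σ (fun _ => ac) (fun _ => uc) (fun _ => θc) N w =
      (canonicalPartition (Torus.geometry (Fin 3)) (hsDiameter σ N) (N + 1)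
          (localGibbsProfile (fun _ => ac) (fun _ => uc) (fun _ => θc)))⁻¹ *
        tensorPow (N + 1) (localGibbsProfile (fun _ => ac) (fun _ => uc) (fun _ => θc)) w := by
    simp only [dens, canonicalDensity, Set.indicator_of_mem hw]
  rw [hdens, log_gibbsDensity hσ2 N continuous_const continuous_const continuous_const (fun _ => hac)
    (fun _ => hθc) w, logPair_eq_sum]
  have hlog : ∀ i : Fin (N + 1), Real.log (localGibbsProfile (fun _ => ac) (fun _ => uc) (fun _ => θc) (w i)) =
      Real.log ac + Real.log ((2 * Real.pi * θc) ^ (-(Module.finrank ℝ V3 : ℝ) / 2)) -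
        ‖(w i).2 - uc‖ ^ 2 / (2 * θc) := fun i =>
    log_localGibbsProfile_eq (a := fun _ => ac) (θ := fun _ => θc) (u := fun _ => uc) (w i).1 (w i).2 hac hθc
  simp_rw [hlog]
  rw [Finset.sum_sub_distrib, Finset.sum_const, Finset.card_univ, Fintype.card_fin, nsmul_eq_mul]
  have hs : ∑ i, ‖(w i).2 - uc‖ ^ 2 / (2 * θc) = 2⁻¹ * ∑ i, ‖(w i).2 - uc‖ ^ 2 / θc := by
    rw [Finset.mul_sum]
    exact Finset.sum_congr rfl fun i _ => by ring
  rw [hs]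
  have hN : ((N : ℝ) + 1) ≠ 0 := by positivity
  push_cast
  rw [← mul_assoc, mul_inv_cancel₀ hN, one_mul]

/-- **The Gibbs entropy of the constant-profile local Gibbs law** (`σ ≤ 1/2`, `a_c, θ_c > 0`):
`S(μ₀) = log Z_N(a_c) − (N+1)(log a_c + log (2πθ_c)^{-3/2}) + (3/2)(N+1)`. [folklore] -/
theorem gibbsEntropy_const (hσ2 : σ ≤ 1 / 2) (hac : 0 < ac) (hθc : 0 < θc) (N : ℕ) :
    gibbsEntropy σ (fun _ => ac) (fun _ => uc) (fun _ => θc) N =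
      Real.log (canonicalPartition (Torus.geometry (Fin 3)) (hsDiameter σ N) (N + 1)
          (localGibbsProfile (fun _ => ac) (fun _ => uc) (fun _ => θc))) -
        ((N : ℝ) + 1) * (Real.log ac + Real.log ((2 * Real.pi * θc) ^ (-(Module.finrank ℝ V3 : ℝ) / 2))) +
        3 / 2 * ((N : ℝ) + 1) := by
  haveI := isProbabilityMeasure_localGibbsMeasure (a₀ := fun _ => ac) (θ₀ := fun _ => θc) (u₀ := fun _ => uc)
    continuous_const continuous_const continuous_const (fun _ => hac) (fun _ => hθc) hσ2 N
  set Cst : ℝ := ((N : ℝ) + 1) * (Real.log ac + Real.log ((2 * Real.pi * θc) ^ (-(Module.finrank ℝ V3 : ℝ) / 2))) -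
    Real.log (canonicalPartition (Torus.geometry (Fin 3)) (hsDiameter σ N) (N + 1)
      (localGibbsProfile (fun _ => ac) (fun _ => uc) (fun _ => θc))) with hCst
  obtain ⟨hQi, hQ⟩ := integral_velFluct_localGibbsMeasure (a₀ := fun _ => ac) (θ₀ := fun _ => θc)
    (u₀ := fun _ => uc) hσ2 continuous_const continuous_const continuous_const (fun _ => hac) (fun _ => hθc) N
  rw [gibbsEntropy_eq_neg_integral σ continuous_const continuous_const continuous_const (fun _ => hac.le)
    (fun _ => hθc.le) N]
  have hae : (fun w => Real.log (dens σ (fun _ => ac) (fun _ => uc) (fun _ => θc) N w)) =ᵐ[localGibbsMeasure σ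
      (fun _ => ac) (fun _ => uc) (fun _ => θc) N] fun w => Cst - 2⁻¹ * ∑ i, ‖(w i).2 - uc‖ ^ 2 / θc := by
    filter_upwards [ae_mem_hardSphereDomain σ (a₀ := fun _ => ac) (θ₀ := fun _ => θc) (u₀ := fun _ => uc)
      continuous_const continuous_const continuous_const N] with w hw
    rw [log_dens_const hσ2 hac hθc N hw, hCst]
    ring
  rw [integral_congr_ae hae, integral_sub (integrable_const Cst) (hQi.const_mul _), integral_const,
    integral_const_mul, hQ, smul_eq_mul, probReal_univ, one_mul, hCst]
  ring

/-! ## Constant Euler state: the tilted partition function and the Euler mean -/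

/-- The EXPONENTIAL OF THE TILT EXPONENT at the constant state `(1, u_c, θ_c)` is the local Gibbs profile with the
slice activity `a_Λ = e^{λ₀ + |u_c|²/2θ_c} / (2πθ_c)^{-3/2}`: `e^{Λ·(1,v,|v|²/2)} = a_Λ M_{1,u_c,θ_c}(v)`. [folklore] -/
theorem exp_tiltExponent_const (hθc : 0 < θc) (s : ℝ) (y : T3 × V3) :
    Real.exp (tiltExponent σ (fun _ _ => 1) (fun _ _ => θc) (fun _ _ => uc) s y) =
      localGibbsProfile (fun _ => Real.exp (lam0 σ 1 θc uc + ‖uc‖ ^ 2 / (2 * θc)) /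
        (2 * Real.pi * θc) ^ (-(Module.finrank ℝ V3 : ℝ) / 2)) (fun _ => uc) (fun _ => θc) y := by
  have hR : 0 < (2 * Real.pi * θc) ^ (-(Module.finrank ℝ V3 : ℝ) / 2) :=
    Real.rpow_pos_of_pos (mul_pos (mul_pos two_pos Real.pi_pos) hθc) _
  rw [tiltExponent_eq_sq s y (show (fun (_ : ℝ) (_ : T3) => θc) s y.1 ≠ 0 from hθc.ne')]
  simp only [localGibbsProfile, localMaxwellian, one_mul]
  rw [Real.exp_sub, neg_div (2 * θc) (‖y.2 - uc‖ ^ 2), Real.exp_neg, ← mul_assoc, div_mul_cancel₀ _ hR.ne',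
    div_eq_mul_inv]

/-- `e^{Φ_s(w)} = ∏ᵢ a_Λ M_{1,u_c,θ_c}(vᵢ)`: the tilt weight is the tensor power of the slice profile. [folklore] -/
theorem exp_tiltPot_const (hθc : 0 < θc) {N : ℕ} (s : ℝ) (w : Cfg N) :
    Real.exp (tiltPot σ (fun _ _ => 1) (fun _ _ => θc) (fun _ _ => uc) s w) =
      tensorPow (N + 1) (localGibbsProfile (fun _ => Real.exp (lam0 σ 1 θc uc + ‖uc‖ ^ 2 / (2 * θc)) /
        (2 * Real.pi * θc) ^ (-(Module.finrank ℝ V3 : ℝ) / 2)) (fun _ => uc) (fun _ => θc)) w := by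
  rw [tiltPot, Real.exp_sum, tensorPow]
  exact Finset.prod_congr rfl fun i _ => exp_tiltExponent_const hθc s (w i)

/-- **The tilted partition function at the constant state is a canonical partition function**:
`Z_N(Λ_s) = Z_N(a_Λ)` (disintegration into positions and Gaussian velocities). [folklore] -/
theorem tiltZ_const (hθc : 0 < θc) (N : ℕ) (s : ℝ) :
    tiltZ σ (fun _ _ => 1) (fun _ _ => θc) (fun _ _ => uc) N s =
      ENNReal.ofReal (canonicalPartition (Torus.geometry (Fin 3)) (hsDiameter σ N) (N + 1)
        (localGibbsProfile (fun _ => Real.exp (lam0 σ 1 θc uc + ‖uc‖ ^ 2 / (2 * θc)) /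
          (2 * Real.pi * θc) ^ (-(Module.finrank ℝ V3 : ℝ) / 2)) (fun _ => uc) (fun _ => θc))) := by
  set aS : ℝ := Real.exp (lam0 σ 1 θc uc + ‖uc‖ ^ 2 / (2 * θc)) /
    (2 * Real.pi * θc) ^ (-(Module.finrank ℝ V3 : ℝ) / 2) with haS_def
  have hR : 0 < (2 * Real.pi * θc) ^ (-(Module.finrank ℝ V3 : ℝ) / 2) :=
    Real.rpow_pos_of_pos (mul_pos (mul_pos two_pos Real.pi_pos) hθc) _
  have haS : 0 < aS := div_pos (Real.exp_pos _) hR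
  set D := hardSphereDomain (Torus.geometry (Fin 3)) (N + 1) (hsDiameter σ N) with hD
  have hDm : MeasurableSet D := measurableSet_hardSphereDomain _ Torus.measurable_geometry_sepVec _ _
  calc tiltZ σ (fun _ _ => 1) (fun _ _ => θc) (fun _ _ => uc) N s
      = ∫⁻ w in D, ENNReal.ofReal (tensorPow (N + 1) (localGibbsProfile (fun _ => aS) (fun _ => uc) (fun _ => θc)) w) := by
        rw [tiltZ]
        simp_rw [exp_tiltPot_const hθc]
        rfl
    _ = ∫⁻ w, ENNReal.ofReal (D.indicator (tensorPow (N + 1)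
          (localGibbsProfile (fun _ => aS) (fun _ => uc) (fun _ => θc))) w) * 1 := by
        rw [← lintegral_indicator hDm]
        refine lintegral_congr fun w => ?_
        rw [mul_one]
        by_cases hw : w ∈ D
        · rw [Set.indicator_of_mem hw, Set.indicator_of_mem hw]
        · rw [Set.indicator_of_notMem hw, Set.indicator_of_notMem hw, ENNReal.ofReal_zero]
    _ = ∫⁻ x, ENNReal.ofReal (posWeight (fun _ => aS) (hsDiameter σ N) (N + 1) x) *
          ∫⁻ _v, (1 : ℝ≥0∞) ∂velMeasure (fun _ => uc) (fun _ => θc) x :=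
        lintegral_gibbsWeight_mul continuous_const continuous_const continuous_const (fun _ => haS.le)
          (fun _ => hθc) _ _ measurable_const
    _ = ∫⁻ x, ENNReal.ofReal (posWeight (fun _ => aS) (hsDiameter σ N) (N + 1) x) := by
        simp only [lintegral_const, measure_univ, mul_one]
    _ = ENNReal.ofReal (posPartition (fun _ => aS) (hsDiameter σ N) (N + 1)) :=
        (ofReal_posPartition continuous_const (fun _ => haS.le) _ _).symm
    _ = _ := by
        rw [canonicalPartition_eq_posPartition continuous_const continuous_const continuous_const
          (fun _ => haS.le) (fun _ => hθc)]

/-- **The Euler mean of the tilt at the constant state**: `m_s = λ₀ + |u_c|²/(2θ_c) − 3/2` (`ρ ≡ 1`, `|𝕋³| = 1`).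
[folklore] -/
theorem tiltMean_const (s : ℝ) :
    tiltMean σ (fun _ _ => 1) (fun _ _ => θc) (fun _ _ => uc) s = lam0 σ 1 θc uc + ‖uc‖ ^ 2 / (2 * θc) - 3 / 2 := by
  rw [tiltMean]
  simp only [one_mul, integral_const, smul_eq_mul, probReal_univ]

/-- Scaling of the constant-profile canonical partition function: `Z_N(c) = c^{N+1} Z_N(1)`. [folklore] -/
theorem canonicalPartition_const (c : ℝ) (N : ℕ) :
    canonicalPartition (Torus.geometry (Fin 3)) (hsDiameter σ N) (N + 1)
        (localGibbsProfile (fun _ => c) (fun _ => uc) (fun _ => θc)) =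
      c ^ (N + 1) * canonicalPartition (Torus.geometry (Fin 3)) (hsDiameter σ N) (N + 1)
        (localGibbsProfile (fun _ => (1 : ℝ)) (fun _ => uc) (fun _ => θc)) := by
  rw [show localGibbsProfile (fun _ => c) (fun _ => uc) (fun _ => θc) =
      fun y => c * localGibbsProfile (fun _ => (1 : ℝ)) (fun _ => uc) (fun _ => θc) y from
    funext (KineticWindowGronwallNegative.localGibbsProfile_const_activity c θc uc),
    JaynesSqueezeSqueeze.canonicalPartition_const_mul]

/-! ## The bracket vanishes identically at equilibrium -/

/-- **EQUILIBRIUM UNIT TEST OF THE LINE'S STATICS.**  For constant profiles `(a_c, u_c, θ_c)` (`a_c, θ_c > 0`),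
the constant Euler state `(1, u_c, θ_c)`, `σ ≤ 1/2`, every `N` and every `s`:
`Z_N(Λ_s) = exp (S(μ₀) + (N+1) m_s)` EXACTLY — the bracket `log Z_N(Λ_s) − S(μ₀) − (N+1) m_s` of
`TiltedExcessAt` is identically zero on the equilibrium rung. [folklore] -/
theorem tiltZ_equilibrium_eq (hσ2 : σ ≤ 1 / 2) (hac : 0 < ac) (hθc : 0 < θc) (N : ℕ) (s : ℝ) :
    tiltZ σ (fun _ _ => 1) (fun _ _ => θc) (fun _ _ => uc) N s =
      ENNReal.ofReal (Real.exp (gibbsEntropy σ (fun _ => ac) (fun _ => uc) (fun _ => θc) N +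
        ((N : ℝ) + 1) * tiltMean σ (fun _ _ => 1) (fun _ _ => θc) (fun _ _ => uc) s)) := by
  have hR : 0 < (2 * Real.pi * θc) ^ (-(Module.finrank ℝ V3 : ℝ) / 2) :=
    Real.rpow_pos_of_pos (mul_pos (mul_pos two_pos Real.pi_pos) hθc) _
  have hZ1 : 0 < canonicalPartition (Torus.geometry (Fin 3)) (hsDiameter σ N) (N + 1)
      (localGibbsProfile (fun _ => (1 : ℝ)) (fun _ => uc) (fun _ => θc)) :=
    canonicalPartition_localGibbs_pos hσ2 N continuous_const continuous_const continuous_const (fun _ => one_pos)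
      (fun _ => hθc)
  rw [tiltZ_const hθc N s, gibbsEntropy_const hσ2 hac hθc N, tiltMean_const s,
    canonicalPartition_const (σ := σ) (θc := θc) (uc := uc) ac,
    canonicalPartition_const (σ := σ) (θc := θc) (uc := uc)
      (Real.exp (lam0 σ 1 θc uc + ‖uc‖ ^ 2 / (2 * θc)) / (2 * Real.pi * θc) ^ (-(Module.finrank ℝ V3 : ℝ) / 2)),
    Real.log_mul (pow_pos hac _).ne' hZ1.ne', Real.log_pow]
  set R : ℝ := (2 * Real.pi * θc) ^ (-(Module.finrank ℝ V3 : ℝ) / 2) with hR_def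
  set K : ℝ := lam0 σ 1 θc uc + ‖uc‖ ^ 2 / (2 * θc) with hK_def
  set Z1 : ℝ := canonicalPartition (Torus.geometry (Fin 3)) (hsDiameter σ N) (N + 1)
    (localGibbsProfile (fun _ => (1 : ℝ)) (fun _ => uc) (fun _ => θc)) with hZ1_def
  congr 1
  have halg : ((N + 1 : ℕ) : ℝ) * Real.log ac + Real.log Z1 - ((N : ℝ) + 1) * (Real.log ac + Real.log R) +
      3 / 2 * ((N : ℝ) + 1) + ((N : ℝ) + 1) * (K - 3 / 2) = Real.log Z1 + ((N + 1 : ℕ) : ℝ) * (K - Real.log R) := by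
    push_cast
    ring
  rw [halg, Real.exp_add (Real.log Z1), Real.exp_log hZ1, Real.exp_nat_mul, Real.exp_sub K, Real.exp_log hR]
  exact mul_comm _ _

end TiltedExcessEquilibrium

/-- Registered sub-goal `tiltedExcess_equilibrium` of the crux (stmt-AtomisticToContinuum-14827), the EQUILIBRIUM
INSTANCE of `stub_tiltedExcess`: for constant profiles `(a_c, u_c, θ_c)` with `a_c, θ_c > 0`, the constant Euler
state `(ρ, u, θ) ≡ (1, u_c, θ_c)` and `σ ≤ 1/2`, `TiltedExcessAt` holds at every horizon `t` — with `C = 0`,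
`c = 1`, `N₀ = 0`, since the bracket vanishes identically (`TiltedExcessEquilibrium.tiltZ_equilibrium_eq`).
[folklore] -/
theorem tiltedExcess_equilibrium : ∀ (σ ac θc : ℝ) (uc : V3), σ ≤ 1 / 2 → 0 < ac → 0 < θc → ∀ t : ℝ, TiltedExcessAt σ (fun _ => ac) (fun _ => θc) (fun _ => uc) (fun _ _ => 1) (fun _ _ => θc) (fun _ _ => uc) t := by
  intro σ ac θc uc hσ2 hac hθc t
  refine ⟨1, 0, one_pos, 0, fun N _ s _ => le_of_eq ?_⟩
  rw [TiltedExcessEquilibrium.tiltZ_equilibrium_eq hσ2 hac hθc N s, zero_mul, add_zero]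

end Summit.AtomisticToContinuum.HydrodynamicLimit.Theorems.FibreDeficitTransfer

end
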